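import Summits.Parity.GeneralizedHardyLittlewood.Theorems.PrimeLevelFamEdgeMomentsBeyondDiagonalDiagRemMomentTailBoundPow
import Summits.Parity.GeneralizedHardyLittlewood.Theorems.PrimeLevelFamEdgeMomentsBeyondDiagonalDiagDecorM8Coord
import Summits.Parity.GeneralizedHardyLittlewood.Theorems.BeyondDiagonalBeatsQuarter.CornerAbel
import HarnessLib

/-!
# Route `PrimeLevelFamEdge`, crux K_A `MomentsBeyondDiagonal` (stmt-Parity-20007), line «petersson_layers» v4, stub `stub_diag`:
# **the `m_r`-decorated shifted Selberg COORDINATE is `O(D(n)·log^{c}M)` FOR EVERY MOMENT ORDER `r`** — the coordinate input `hB`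
# of the generic crude families (`…DiagDecorOneSidedCrudeFamily`, `…DiagDecorTwoSidedCrudeFamily`) for ALL decorations at once

First brick of the generic order `(i,j)` of `stub_diag` (repair census `Cruxes/MomentsBeyondDiagonal/Lines/petersson_layers_stub_diag_g18_rung4.md`,
item (G2)). In the Hecke-summed order-`(i,j)` weight (`…DiagDecorOrderHecke.heckeSum_order_eq i j`, generic) the arithmetic decorations
are the divisor-log moments `S_t(k) = Σ_{d∣k}(2log d − log k)^t = Σ_{de=k}(log d − log e)^t = τ(k)·m_t(k)`. Lineage famedge-2 bounded the
shifted Selberg coordinates of `m₄, m₆, m₈` one decoration at a time (`…DiagDecorM4Coord/M6Coord/M8Coord`, through the leading-coefficient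
cancellations `m4/m6/m8_cancellation` of the monomial families, sizes `D(n)(1+κ(n))log^{c+r+1}, …, log^{c+r+5}`). The convergent-tail theorem
«DRTAIL»_r of lineage famedge-1 g17 (`…DiagRemMomentTailBoundPow.abs_sum_Wn_logDiff_pow_sub_le_pow r A`: `Σ_{k≤y} W_n(k)S_r(k) = c_n +
O(D(n)(1+log y)^{−A})`, `|c_n| ≤ C·D(n)`, EVERY `r`) gives all of them, and every higher `r`, in one stroke with the exponent `e = 0` for every `r` (the `m₄` exponent; sharper than the
`m₆`/`m₈` ones): the
partial sums `Σ_{k≤e} W_n(k)S_r(k)` are bounded by `2C·D(n)` uniformly in `e`, so discrete Abel summation against the antitone weight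
`ℓ⁺_y(k)^m` (`…CornerAbel.abs_sum_Ioc_mul_prod_le`) bounds `Σ_{k≤y} W_n(k)S_r(k)log^m(y/k)` by `4C·D(n)·log^m y` — for every `m`, with
ONE constant depending on `r` only.

* `abs_sum_Wn_logDiff_pow_mul_log_pow_le` — **`|Σ_{k≤y} W_n(k)·S_r(k)·log^m(y/k)| ≤ C_r·D(n)·log^m y`** (`n ≥ 1`, `y ≥ 1`, all `m`);
* `abs_shiftedCoord_logDiff_le` — **the shifted coordinate bound in the `hB`-shape of `…DiagDecorOneSidedCrudeFamily.abs_selbergOneSidedCrudeLpow_le`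
  with decoration `D = m_r = S_r/τ` and exponent `e = 0`**: `|Σ_c P_c·(Σ_{k≤M/n,(k,n)=1} W(k)τ(k)m_r(k)log^{c+ρ}((M/n)/k))/logᶜM| ≤
  K·D(n)(1+κ(n))·log^{ρ+1}M` (`M ≥ 3`, `1 ≤ n ≤ M`; any profile `P`, no vanishing conditions needed).

Hence, for every even `t ≥ 4`, the one-sided family bound `|Sel(τm_t(k₁)·τ(k₂)·L^m)| ≤ C·log^m M` and (with the crude `(1+κ)`-free
twin for the second factor, same proof) the two-sided bounds follow from the landed generic families — no per-decoration cancellation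
identity is ever needed again. Def-free; theorems only. Helper `--supports stmt-Parity-20007`; closes nothing; K_A, K_B and the Parity
summit are NOT proved; nothing about Landau–Siegel zeros.

## References
* E. Kowalski, P. Michel, J. VanderKam, J. reine angew. Math. 526 (2000), (23)–(28) pp. 13–15 and Prop. 5.1 p. 18.
  [cite: KowalskiMichelVanderKam2000, (23)–(28) and Prop. 5.1 — derivation (divisor-log moments of the Selberg coordinates, every order)]
-/

noncomputable section

open scoped Real
open Finset ArithmeticFunction Polynomial

namespace Summit.Parity.GeneralizedHardyLittlewood.Theorems.MomentsBeyondDiagonal.DiagKernel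

open Literature.NumberTheory.LFunctions Literature.NumberTheory.LFunctions.KMV2000
open MollifierMainTerm (W)
open SelbergCoord (kappa)
open Literature.NumberTheory.Sieve (one_le_log_of_three_le)
open Summit.Parity.GeneralizedHardyLittlewood.Theorems.BeyondDiagonalBeatsQuarter.KernelFormXSq (divWeight divWeight_nonneg)
open Summit.Parity.GeneralizedHardyLittlewood.Theorems.BeyondDiagonalBeatsQuarter.Corner
  (ellp ellp_nonneg ellp_eq_log ellp_le_log' ellp_succ_le ellp_eq_zero abs_sum_Ioc_mul_prod_le)
open Summit.Parity.GeneralizedHardyLittlewood.Theorems.MomentsBeyondDiagonal.DiagCorner (abs_sum_Wn_logDiff_pow_sub_le_pow)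

/-- **`|Σ_{k≤y} W_n(k)·S_r(k)·log^m(y/k)| ≤ C_r·D(n)·log^m y`** for `n ≥ 1`, `y ≥ 1` and EVERY `m` (`S_r(k) = Σ_{de=k}(log d − log e)^r`):
«DRTAIL»_r (uniformly bounded partial sums) and discrete Abel summation against `ℓ⁺_y(k)^m`.
[cite: KowalskiMichelVanderKam2000, Prop. 5.1 — derivation (decorated Selberg coefficients, every order)] -/
theorem abs_sum_Wn_logDiff_pow_mul_log_pow_le (r : ℕ) :
    ∃ C : ℝ, 0 ≤ C ∧ ∀ n : ℕ, n ≠ 0 → ∀ (m : ℕ) (y : ℝ), 1 ≤ y →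
      |∑ k ∈ Icc 1 ⌊y⌋₊, (if k.Coprime n then W k else 0) *
          (∑ z ∈ k.divisorsAntidiagonal, (Real.log z.1 - Real.log z.2) ^ r) * Real.log (y / k) ^ m| ≤
        C * divWeight n * Real.log y ^ m := by
  classical
  obtain ⟨C, hC0, hC⟩ := abs_sum_Wn_logDiff_pow_sub_le_pow r 0
  refine ⟨4 * C, by positivity, fun n hn m y hy ↦ ?_⟩
  obtain ⟨c, hc, hT⟩ := hC n hn
  have hD : 0 ≤ divWeight n := divWeight_nonneg n
  have hy0 : 0 ≤ y := by linarith
  have hly : 0 ≤ Real.log y := Real.log_nonneg hy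
  set b : ℕ → ℝ := fun k ↦ (if k.Coprime n then W k else 0) *
    ∑ z ∈ k.divisorsAntidiagonal, (Real.log z.1 - Real.log z.2) ^ r with hb
  -- uniformly bounded partial sums
  have hpart : ∀ e : ℕ, |∑ k ∈ Icc 1 e, b k| ≤ 2 * C * divWeight n := by
    intro e
    rcases Nat.eq_zero_or_pos e with rfl | he
    · rw [show Icc (1 : ℕ) 0 = ∅ from Finset.Icc_eq_empty (by norm_num), Finset.sum_empty, abs_zero]
      positivity
    · have h1 : (1 : ℝ) ≤ e := by exact_mod_cast he
      have h := hT e h1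
      rw [Nat.floor_natCast, pow_zero, div_one] at h
      calc |∑ k ∈ Icc 1 e, b k| = |(∑ k ∈ Icc 1 e, b k - c) + c| := by rw [sub_add_cancel]
        _ ≤ |∑ k ∈ Icc 1 e, b k - c| + |c| := abs_add_le _ _
        _ ≤ C * divWeight n + C * divWeight n := add_le_add h hc
        _ = 2 * C * divWeight n := by ring
  have hsum : ∑ k ∈ Icc 1 ⌊y⌋₊, (if k.Coprime n then W k else 0) *
        (∑ z ∈ k.divisorsAntidiagonal, (Real.log z.1 - Real.log z.2) ^ r) * Real.log (y / k) ^ m =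
      ∑ k ∈ Ioc 0 ⌊y⌋₊, b k * (ellp y k ^ m * 1) := by
    have hI : Icc 1 ⌊y⌋₊ = Ioc 0 ⌊y⌋₊ := by
      ext k; simp only [Finset.mem_Icc, Finset.mem_Ioc]; omega
    rw [← hI]
    refine Finset.sum_congr rfl fun k hk ↦ ?_
    rw [ellp_eq_log hy0 hk, hb, mul_one]
  rw [hsum]
  rcases Nat.eq_zero_or_pos m with rfl | hm
  · -- `m = 0`: the partial sum itself
    have hI : Ioc 0 ⌊y⌋₊ = Icc 1 ⌊y⌋₊ := by
      ext k; simp only [Finset.mem_Icc, Finset.mem_Ioc]; omega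
    simp only [pow_zero, mul_one, hI]
    calc |∑ k ∈ Icc 1 ⌊y⌋₊, b k| ≤ 2 * C * divWeight n := hpart _
      _ ≤ 4 * C * divWeight n := by nlinarith [mul_nonneg hC0 hD]
  · -- `m ≥ 1`: Abel summation against the antitone weight `ℓ⁺_y(k)^m`, vanishing at `⌊y⌋ + 1`
    have hm0 : m ≠ 0 := by omega
    have key := abs_sum_Ioc_mul_prod_le b (f := fun e ↦ ellp y e ^ m) (h := fun _ ↦ (1 : ℝ))
      (u := 0) (w := ⌊y⌋₊) (Nat.zero_le _) (B := 2 * C * divWeight n) (F := Real.log y ^ m) (H := 1)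
      (by positivity)
      (fun e _ _ ↦ by
        rw [show Icc (1 : ℕ) 0 = ∅ from Finset.Icc_eq_empty (by norm_num), Finset.sum_empty, sub_zero]
        exact hpart e)
      (fun e ↦ pow_nonneg (ellp_nonneg y e) m)
      (fun e ↦ pow_le_pow_left₀ (ellp_nonneg y e) (ellp_le_log' hy e) m)
      (fun e he ↦ pow_le_pow_left₀ (ellp_nonneg y (e + 1)) (ellp_succ_le hy0 (by omega)) m)
      (by simp only [ellp_eq_zero hy0 le_rfl, zero_pow hm0])
      (fun _ _ ↦ zero_le_one) (fun _ _ _ ↦ le_rfl) (fun _ _ ↦ le_rfl)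
    refine key.trans (le_of_eq ?_)
    ring

/-- **The `m_r`-decorated shifted Selberg coordinate is `O(D(n)(1+κ(n))·log^{ρ+1}M)` for EVERY `r`** — the hypothesis `hB` of
`…DiagDecorOneSidedCrudeFamily.abs_selbergOneSidedCrudeLpow_le` for the decoration `D = m_r = S_r/τ` with `e = 0` (any profile `P`;
`M ≥ 3`, `1 ≤ n ≤ M`). [cite: KowalskiMichelVanderKam2000, (23)–(28) — derivation (divisor-log moments of the Selberg coordinates)] -/
theorem abs_shiftedCoord_logDiff_le (r : ℕ) (P : ℝ[X]) (ρ : ℕ) :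
    ∃ K : ℝ, 0 ≤ K ∧ ∀ M : ℝ, 3 ≤ M → ∀ n : ℕ, n ≠ 0 → (n : ℝ) ≤ M →
      |∑ c ∈ Finset.range (P.natDegree + 1), P.coeff c *
          ((∑ k ∈ Icc 1 ⌊M / n⌋₊, (if k.Coprime n then W k else 0) *
              ((k.divisors.card : ℝ) *
                ((∑ z ∈ k.divisorsAntidiagonal, (Real.log z.1 - Real.log z.2) ^ r) / (k.divisors.card : ℝ))) *
            Real.log (M / n / k) ^ (c + ρ)) / Real.log M ^ c)| ≤
        K * divWeight n * (1 + kappa n) * Real.log M ^ (ρ + 1) := by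
  classical
  obtain ⟨C, hC0, hC⟩ := abs_sum_Wn_logDiff_pow_mul_log_pow_le r
  set K : ℝ := ∑ c ∈ Finset.range (P.natDegree + 1), |P.coeff c| * C with hK
  have hK0 : 0 ≤ K := Finset.sum_nonneg fun c _ ↦ by positivity
  refine ⟨K, hK0, fun M hM n hn hnM ↦ ?_⟩
  set ℓ := Real.log M with hℓ
  have hℓ1 : 1 ≤ ℓ := one_le_log_of_three_le hM
  have hℓ0 : 0 < ℓ := by linarith
  have hD := divWeight_nonneg n
  have hκ : 0 ≤ kappa n := by
    unfold kappa
    exact Finset.sum_nonneg fun p hp ↦ by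
      have hp2 : (2 : ℝ) ≤ p := by exact_mod_cast (Nat.prime_of_mem_primeFactors hp).two_le
      exact div_nonneg (Real.log_nonneg (by linarith)) (by linarith)
  obtain ⟨hY0, hYℓ⟩ := log_div_nonneg_and_le hM hn hnM
  have hn0 : (0 : ℝ) < n := by exact_mod_cast Nat.pos_of_ne_zero hn
  have hy1 : 1 ≤ M / n := (one_le_div hn0).2 hnM
  -- `τ(k)·(S_r(k)/τ(k)) = S_r(k)` on `k ≥ 1`
  have hre : ∀ c : ℕ, ∑ k ∈ Icc 1 ⌊M / n⌋₊, (if k.Coprime n then W k else 0) *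
        ((k.divisors.card : ℝ) *
          ((∑ z ∈ k.divisorsAntidiagonal, (Real.log z.1 - Real.log z.2) ^ r) / (k.divisors.card : ℝ))) *
        Real.log (M / n / k) ^ (c + ρ) =
      ∑ k ∈ Icc 1 ⌊M / n⌋₊, (if k.Coprime n then W k else 0) *
        (∑ z ∈ k.divisorsAntidiagonal, (Real.log z.1 - Real.log z.2) ^ r) * Real.log (M / n / k) ^ (c + ρ) := by
    intro c
    refine Finset.sum_congr rfl fun k hk ↦ ?_
    have hk0 : k ≠ 0 := by have := (Finset.mem_Icc.1 hk).1; omega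
    have hτ : (k.divisors.card : ℝ) ≠ 0 := by
      have : 0 < k.divisors.card := Finset.card_pos.2 ⟨k, Nat.mem_divisors_self k hk0⟩
      exact_mod_cast this.ne'
    rw [mul_div_cancel₀ _ hτ]
  -- termwise
  have hterm : ∀ c ∈ Finset.range (P.natDegree + 1),
      |P.coeff c * ((∑ k ∈ Icc 1 ⌊M / n⌋₊, (if k.Coprime n then W k else 0) *
          ((k.divisors.card : ℝ) *
            ((∑ z ∈ k.divisorsAntidiagonal, (Real.log z.1 - Real.log z.2) ^ r) / (k.divisors.card : ℝ))) *
          Real.log (M / n / k) ^ (c + ρ)) / ℓ ^ c)| ≤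
        |P.coeff c| * C * (divWeight n * (1 + kappa n) * ℓ ^ (ρ + 1)) := by
    intro c _
    rw [hre c, abs_mul, abs_div, abs_of_pos (pow_pos hℓ0 c)]
    have hS := hC n hn (c + ρ) (M / n) hy1
    have hB : C * divWeight n * Real.log (M / n) ^ (c + ρ) ≤ (C * (divWeight n * (1 + kappa n) * ℓ ^ (ρ + 1))) * ℓ ^ c := by
      have h1 : Real.log (M / n) ^ (c + ρ) ≤ ℓ ^ (c + ρ) := pow_le_pow_left₀ hY0 hYℓ _
      have h2 : ℓ ^ (c + ρ) ≤ ℓ ^ (c + ρ) * ℓ := le_mul_of_one_le_right (by positivity) hℓ1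
      have h3 : divWeight n ≤ divWeight n * (1 + kappa n) := le_mul_of_one_le_right hD (by linarith)
      calc C * divWeight n * Real.log (M / n) ^ (c + ρ) ≤ C * (divWeight n * (1 + kappa n)) * (ℓ ^ (c + ρ) * ℓ) := by
            gcongr
            exact h1.trans h2
        _ = (C * (divWeight n * (1 + kappa n) * ℓ ^ (ρ + 1))) * ℓ ^ c := by ring
    have hB' := (div_le_iff₀ (pow_pos hℓ0 c)).2 (hS.trans hB)
    calc _ ≤ |P.coeff c| * (C * (divWeight n * (1 + kappa n) * ℓ ^ (ρ + 1))) :=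
          mul_le_mul_of_nonneg_left hB' (abs_nonneg _)
      _ = _ := by ring
  calc _ ≤ ∑ c ∈ Finset.range (P.natDegree + 1), |P.coeff c * ((∑ k ∈ Icc 1 ⌊M / n⌋₊, (if k.Coprime n then W k else 0) *
          ((k.divisors.card : ℝ) *
            ((∑ z ∈ k.divisorsAntidiagonal, (Real.log z.1 - Real.log z.2) ^ r) / (k.divisors.card : ℝ))) *
          Real.log (M / n / k) ^ (c + ρ)) / ℓ ^ c)| := Finset.abs_sum_le_sum_abs _ _
    _ ≤ ∑ c ∈ Finset.range (P.natDegree + 1), |P.coeff c| * C * (divWeight n * (1 + kappa n) * ℓ ^ (ρ + 1)) :=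
        Finset.sum_le_sum hterm
    _ = K * divWeight n * (1 + kappa n) * ℓ ^ (ρ + 1) := by
        rw [hK, Finset.sum_mul, Finset.sum_mul, Finset.sum_mul]
        exact Finset.sum_congr rfl fun c _ ↦ by ring

end Summit.Parity.GeneralizedHardyLittlewood.Theorems.MomentsBeyondDiagonal.DiagKernel

end
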